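import Mathlib
import HarnessLib
import Literature.ComputerArithmetic.DeDinechinLauterMullerTorres2013.ZivRoundingTest
import Literature.ComputerArithmetic.BrisebarreHanrotMullerZimmermann2025.ExactCases

/-!
# Lefèvre–Ly–Zimmermann (ARITH 2026): the candidate check by two roundings, and
"`m` identical bits after the round bit" versus `m`-bad cases

V. Lefèvre, T. Ly, P. Zimmermann, *Computing hard-to-round cases of sin, cos, tan in double precision*,
ARITH 2026 (33rd IEEE Symposium on Computer Arithmetic, Fulda, June 2026), extended version HAL
hal-05593313v2 [LefevreLyZimmermann2026]. The search algorithm of the paper (Algorithms 1–3,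
`SearchAll`/`SearchOne`, with the 50-page error analysis behind its Theorem 1) is an IMPLEMENTATION and is
not transcribed. What we formalise is the final, exact filter every candidate goes through and the
paper's lemma about it (Appendix A):

> **Algorithm 4 (Check).** Input: a binary64 number `x`, an integer `m`. Output: output `x` if `sin x`
> has at least `m` identical bits after the round bit. 1: `y ← RN₅₃₊ₘ(sin x)`; 2: `z ← RN₅₄(y)`;
> 3: if `z = y` output `x`.
>
> **Lemma 2.** Algorithm Check is correct: if `sin x` has at least `m` identical bits after the round
> bit, then `x` is output. [Proof: … In both cases, `y` is representable on 54 bits, thus `z = y`.]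
> Conversely, when `x` is output by Check, `sin x` … has at least `m` identical bits after the round bit
> (… since `sin x` cannot be exact for any non-zero floating-point number `x`).

Everything is stated for a general precision `p ≥ 1` (binary64: `p = 53`) in the float model of
`Literature.ComputerArithmetic.DeDinechinLauterMullerTorres2013` (`IsFloat q` = precision-`q` numbers with
unbounded exponent range, `IsRoundNearest q RN` = ANY round-to-nearest into them — the paper uses MPFR,
i.e. ties-to-even, one such function), for a real value `v` (= `sin x`) lying in the binade
`2^e ≤ |v| < 2^(e+1)`:

* `HasIdenticalBits p m e v` — the paper's "`v` has at least `m` identical bits after the round bit":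
  the binary expansion of `|v|` reads `b₁b₂…b_{p+1} 0^m c…` or `b₁b₂…b_{p+1} 1^m c…` (`b_{p+1}` is the round
  bit), i.e. `v` is within `2^(−m)·ulp_{p+1} = 2^(e−p−m)` of a `(p+1)`-bit number (the upper `p+1` bits
  `y₀`, resp. "the 54-bit number adjacent to `y₀` away from zero"). We take this DISTANCE form,
  `∃ b ∈ 𝔽_{p+1}, |v − b| < 2^(e−p−m)`, as the definition; for a `v` that is not a `(p+m+1)`-bit number
  (e.g. an irrational `v`, the only case the paper meets) it is equivalent to the digit form, while for
  dyadic `v` the digit form depends on the choice of expansion at distance exactly `2^(e−p−m)`.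
* `check_outputs` — Lemma 2 as printed: `HasIdenticalBits p m e v ⇒ RN_{p+1}(RN_{p+m}(v)) = RN_{p+m}(v)`
  (`m ≥ 1`; the step "sin x is rounded at line 1 to y₀ [or its neighbour]" is `rn_eq_of_near_float`).
* `hasIdenticalBits_of_check_outputs` — the printed converse, under the hypothesis that `v` is not a
  `(p+m+1)`-bit number (`¬ IsFloat (p+m+1) v`; the paper: "sin x cannot be exact"), with the half-ulp
  bound `abs_rn_sub_le_half_ulp` and the tie analysis `isFloat_succ_of_abs_rn_sub_eq`.
* `hasIdenticalBits_iff_isBadCase` — the dictionary with the survey vocabulary of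
  `Literature.ComputerArithmetic.BrisebarreHanrotMullerZimmermann2025` [BrisebarreEtAl2025, §4.4]: with
  `y = 2^(p−1−e)·v` the scaled value (ulp = 1, as in `scaled f p e₁ e X`),
  `HasIdenticalBits p m e v ↔ IsBadCaseDir (m+1) y ∨ IsBadCaseRN (m+1) y` — "at least `m` identical bits
  after the round bit" is "(m+1)-bad for a directed rounding or for round-to-nearest" (the run of equal
  bits continues the round bit towards a FLOAT, or opposes it towards a MIDPOINT).
* `check_sin_iff`, `check_cos_iff`, `check_tan_iff` — Lemma 2 with its converse for `sin`, `cos`, `tan`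
  at a non-zero rational (in particular binary64) argument, any precision: the Check output condition is
  EQUIVALENT to `HasIdenticalBits p m e`, by the transcendence / irrationality results of
  `TableMakersDilemma.lean` / `ExactCases.lean`; and `check_sin_iff_isBadCase`, the same on the grid
  `x = X·2^(e₁−p+1)` in terms of `scaled Real.sin p e₁ e X`.

All statements are theorems (0 named facts); `HasIdenticalBits` is a definition with a body.
-/

namespace Literature.ComputerArithmetic.LefevreLyZimmermann2026

open Literature.ComputerArithmetic.DeDinechinLauterMullerTorres2013
open Literature.ComputerArithmetic.BrisebarreHanrotMullerZimmermann2025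

/-! ### Float toolkit (precision monotonicity, rationality, half-ulp error of a nearest rounding) -/

/-- `𝔽_p ⊆ 𝔽_q` for `p ≤ q`. [cite: LefevreLyZimmermann2026, Appendix A] -/
theorem isFloat_mono {p q : ℕ} (hpq : p ≤ q) {x : ℝ} (hx : IsFloat p x) : IsFloat q x := by
  obtain ⟨M, E, hM, rfl⟩ := hx
  exact ⟨M, E, lt_of_lt_of_le hM (pow_le_pow_right₀ (by norm_num) hpq), rfl⟩

/-- A floating-point number is rational; an irrational real is a float of no precision ("sin x cannot be
exact for any non-zero floating-point number x"). [cite: LefevreLyZimmermann2026, Appendix A] -/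
theorem not_isFloat_of_irrational {p : ℕ} {x : ℝ} (hx : Irrational x) : ¬ IsFloat p x := by
  rintro ⟨M, E, -, rfl⟩
  exact hx ⟨(M : ℚ) * (2 : ℚ) ^ E, by push_cast; rfl⟩

/-- The float `|b|` for a float `b`. [cite: LefevreLyZimmermann2026, Appendix A] -/
theorem isFloat_abs {p : ℕ} {b : ℝ} (hb : IsFloat p b) : IsFloat p |b| := by
  rcases abs_choice b with h | h
  · rw [h]; exact hb
  · rw [h]; exact hb.neg

/-- Positive-argument case of `abs_rn_sub_le_half_ulp` (the floats `K·u`, `(K+1)·u` bracketing `v`,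
`u = 2^(e−q+1)`). [folklore] -/
private theorem abs_rn_sub_le_half_ulp_pos {q : ℕ} {RN : ℝ → ℝ} (h : IsRoundNearest q RN) (hq : 1 ≤ q)
    {v : ℝ} {e : ℤ} (hv1 : (2 : ℝ) ^ e ≤ v) (hv2 : v < (2 : ℝ) ^ (e + 1)) :
    |RN v - v| ≤ (2 : ℝ) ^ (e - q) := by
  have hu0 : (0 : ℝ) < (2 : ℝ) ^ (e - q + 1) := by positivity
  have hu2 : (2 : ℝ) ^ (e - q + 1) = 2 * (2 : ℝ) ^ (e - q) := by
    rw [zpow_add_one₀ two_ne_zero]; ring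
  have htop : (2 : ℝ) ^ (e + 1) = ((2 ^ q : ℤ) : ℝ) * (2 : ℝ) ^ (e - q + 1) := by
    push_cast; rw [← zpow_natCast, ← zpow_add₀ two_ne_zero]; congr 1; ring
  obtain ⟨K, hK⟩ : ∃ K : ℤ, K = ⌊v / (2 : ℝ) ^ (e - q + 1)⌋ := ⟨_, rfl⟩
  have hK1 : (K : ℝ) * (2 : ℝ) ^ (e - q + 1) ≤ v := by
    have := Int.floor_le (v / (2 : ℝ) ^ (e - q + 1))
    rw [← hK] at this
    calc (K : ℝ) * (2 : ℝ) ^ (e - q + 1) ≤ v / (2 : ℝ) ^ (e - q + 1) * (2 : ℝ) ^ (e - q + 1) :=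
          mul_le_mul_of_nonneg_right this hu0.le
      _ = v := div_mul_cancel₀ v hu0.ne'
  have hK2 : v < ((K : ℝ) + 1) * (2 : ℝ) ^ (e - q + 1) := by
    have := Int.lt_floor_add_one (v / (2 : ℝ) ^ (e - q + 1))
    rw [← hK] at this
    calc v = v / (2 : ℝ) ^ (e - q + 1) * (2 : ℝ) ^ (e - q + 1) := (div_mul_cancel₀ v hu0.ne').symm
      _ < ((K : ℝ) + 1) * (2 : ℝ) ^ (e - q + 1) := mul_lt_mul_of_pos_right this hu0
  have hKlt : K < 2 ^ q := by
    have : (K : ℝ) * (2 : ℝ) ^ (e - q + 1) < ((2 ^ q : ℤ) : ℝ) * (2 : ℝ) ^ (e - q + 1) := by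
      rw [← htop]; linarith
    exact_mod_cast lt_of_mul_lt_mul_right this hu0.le
  have hK0 : 0 ≤ K := by
    rw [hK]; exact Int.floor_nonneg.2 (div_nonneg (by linarith [hu0, (by positivity : (0:ℝ) < 2 ^ e)])
      hu0.le)
  have hf1 : IsFloat q ((K : ℝ) * (2 : ℝ) ^ (e - q + 1)) :=
    ⟨K, e - q + 1, by rw [abs_of_nonneg hK0]; exact hKlt, rfl⟩
  have hf2 : IsFloat q (((K : ℝ) + 1) * (2 : ℝ) ^ (e - q + 1)) := by
    have := IsFloat.of_abs_le hq (K := K + 1) (E := e - q + 1)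
      (by rw [abs_of_nonneg (by omega)]; omega)
    push_cast at this; exact this
  have h1 := h.nearest v _ hf1
  have h2 := h.nearest v _ hf2
  rcases le_or_gt (v - K * (2 : ℝ) ^ (e - q + 1)) ((2 : ℝ) ^ (e - q)) with hlo | hhi
  · calc |RN v - v| ≤ |(K : ℝ) * (2 : ℝ) ^ (e - q + 1) - v| := h1
      _ = v - K * (2 : ℝ) ^ (e - q + 1) := by rw [abs_sub_comm, abs_of_nonneg (by linarith)]
      _ ≤ (2 : ℝ) ^ (e - q) := hlo
  · calc |RN v - v| ≤ |((K : ℝ) + 1) * (2 : ℝ) ^ (e - q + 1) - v| := h2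
      _ = ((K : ℝ) + 1) * (2 : ℝ) ^ (e - q + 1) - v := abs_of_nonneg (by linarith)
      _ ≤ (2 : ℝ) ^ (e - q) := by rw [add_mul, one_mul, hu2] at *; linarith

/-- HALF-ULP ERROR OF A NEAREST ROUNDING: if `2^e ≤ |v| < 2^(e+1)` then `|RN_q(v) − v| ≤ 2^(e−q)`
(`= ½·ulp_q` of the binade; "RN₅₃₊ₘ(sin x) rounds sin x to nearest to a precision of 53 + m bits").
[cite: LefevreLyZimmermann2026, Appendix A] -/
theorem abs_rn_sub_le_half_ulp {q : ℕ} {RN : ℝ → ℝ} (h : IsRoundNearest q RN) (hq : 1 ≤ q)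
    {v : ℝ} {e : ℤ} (hv1 : (2 : ℝ) ^ e ≤ |v|) (hv2 : |v| < (2 : ℝ) ^ (e + 1)) :
    |RN v - v| ≤ (2 : ℝ) ^ (e - q) := by
  rcases le_or_gt 0 v with hv0 | hv0
  · rw [abs_of_nonneg hv0] at hv1 hv2
    exact abs_rn_sub_le_half_ulp_pos h hq hv1 hv2
  · rw [abs_of_neg hv0] at hv1 hv2
    have := abs_rn_sub_le_half_ulp_pos h.mirror hq hv1 hv2
    simp only [neg_neg] at this
    rwa [show -RN v - -v = -(RN v - v) by ring, abs_neg] at this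

/-- Positive-argument case of `rn_eq_of_near_float` (trichotomy `b > 2^e` / `b = 2^e` / `b < 2^e`).
[folklore] -/
private theorem rn_eq_of_near_float_pos {q q' : ℕ} {RN : ℝ → ℝ} (h : IsRoundNearest q RN)
    (hq' : 1 ≤ q') (hqq : q' ≤ q) {v b : ℝ} {e : ℤ} (hv : (2 : ℝ) ^ e ≤ v) (hb : IsFloat q' b)
    (hvb : |v - b| < (2 : ℝ) ^ (e - q)) : RN v = b := by
  have hq : 1 ≤ q := le_trans hq' hqq
  have hbq : IsFloat q b := isFloat_mono hqq hb
  have hhalf : (2 : ℝ) ^ (e - q + 1) / 2 = (2 : ℝ) ^ (e - q) := by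
    rw [zpow_add_one₀ two_ne_zero]; ring
  rcases lt_trichotomy ((2 : ℝ) ^ e) b with hlt | heq | hgt
  · exact h.rn_eq_of_abs_sub_lt_half_ulp hq hbq hlt (by rw [hhalf, abs_sub_comm]; exact hvb)
  · rw [← heq]
    refine h.rn_eq_two_zpow hq ?_ ?_
    · have : (0 : ℝ) < (2 : ℝ) ^ (e - q + 1) / 4 := by positivity
      linarith
    · have := (abs_lt.1 hvb).2
      rw [hhalf]; linarith
  · exfalso
    have hble := hb.le_sub_of_lt hq' hgt
    have hmono : (2 : ℝ) ^ (e - q) ≤ (2 : ℝ) ^ (e - q') :=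
      zpow_le_zpow_right₀ (by norm_num) (by omega)
    have := (abs_lt.1 hvb).2
    linarith

/-- "sin x IS ROUNDED AT LINE 1 TO y₀ [resp. to the 54-bit number adjacent to y₀ away from zero]": if
`|v| ≥ 2^e` and `v` is within `2^(e−q)` (half an ulp of the binade `[2^e, 2^(e+1))` in precision `q`) of a
precision-`q'` number `b`, `q' ≤ q`, then `RN_q(v) = b` — whatever the tie-breaking rule, and including the
cases `b = 2^e` and `b = 2^(e+1)` at the ends of the binade. [cite: LefevreLyZimmermann2026, Appendix A] -/
theorem rn_eq_of_near_float {q q' : ℕ} {RN : ℝ → ℝ} (h : IsRoundNearest q RN) (hq' : 1 ≤ q')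
    (hqq : q' ≤ q) {v b : ℝ} {e : ℤ} (hv : (2 : ℝ) ^ e ≤ |v|) (hb : IsFloat q' b)
    (hvb : |v - b| < (2 : ℝ) ^ (e - q)) : RN v = b := by
  rcases le_or_gt 0 v with hv0 | hv0
  · rw [abs_of_nonneg hv0] at hv
    exact rn_eq_of_near_float_pos h hq' hqq hv hb hvb
  · rw [abs_of_neg hv0] at hv
    have := rn_eq_of_near_float_pos h.mirror hq' hqq hv hb.neg
      (by rw [show -v - -b = -(v - b) by ring, abs_neg]; exact hvb)
    simp only [neg_neg] at this
    linarith

/-- THE TIE CASE IS A FLOAT OF THE NEXT PRECISION: if `y ∈ 𝔽_q`, `2^e ≤ |v| < 2^(e+1)` and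
`|y − v| = 2^(e−q)` exactly, then `v ∈ 𝔽_{q+1}` (so an irrational `v` is never at distance exactly half an
ulp from its rounding). [cite: LefevreLyZimmermann2026, Appendix A] -/
theorem isFloat_succ_of_abs_sub_eq {q : ℕ} (hq : 1 ≤ q) {y v : ℝ} {e : ℤ} (hy : IsFloat q y)
    (hv1 : (2 : ℝ) ^ e ≤ |v|) (hv2 : |v| < (2 : ℝ) ^ (e + 1)) (heq : |y - v| = (2 : ℝ) ^ (e - q)) :
    IsFloat (q + 1) v := by
  have hu0 : (0 : ℝ) < (2 : ℝ) ^ (e - q) := by positivity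
  have hhalf : (2 : ℝ) ^ (e - q) ≤ (2 : ℝ) ^ (e - 1) := zpow_le_zpow_right₀ (by norm_num) (by omega)
  have he1 : (2 : ℝ) ^ e = 2 * (2 : ℝ) ^ (e - 1) := by
    rw [← zpow_one_add₀ two_ne_zero]; congr 1; ring
  have hyabs : (2 : ℝ) ^ (e - 1) ≤ |y| := by
    have h1 : |v| - |y| ≤ |y - v| := by rw [abs_sub_comm]; exact abs_sub_abs_le_abs_sub v y
    linarith
  obtain ⟨K, hK⟩ := hy.exists_int_mul_of_le hyabs
  have hexp : (e - 1 - (q : ℤ) + 1) = e - q := by ring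
  rw [hexp] at hK
  have htop : (2 : ℝ) ^ (e + 1) = ((2 ^ (q + 1) : ℤ) : ℝ) * (2 : ℝ) ^ (e - q) := by
    push_cast; rw [← zpow_natCast, ← zpow_add₀ two_ne_zero]; congr 1; push_cast; ring
  -- v = (K ∓ 1)·2^(e−q)
  obtain ⟨N, hN⟩ : ∃ N : ℤ, v = (N : ℝ) * (2 : ℝ) ^ (e - q) := by
    rcases (abs_eq hu0.le).1 heq with h | h
    · exact ⟨K - 1, by push_cast; rw [sub_mul, one_mul, ← hK]; linarith⟩
    · exact ⟨K + 1, by push_cast; rw [add_mul, one_mul, ← hK]; linarith⟩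
  refine ⟨N, e - q, ?_, hN⟩
  have h5 : |(N : ℝ)| * (2 : ℝ) ^ (e - q) < ((2 ^ (q + 1) : ℤ) : ℝ) * (2 : ℝ) ^ (e - q) := by
    rw [← htop]
    calc |(N : ℝ)| * (2 : ℝ) ^ (e - q) = |v| := by rw [hN, abs_mul, abs_of_pos hu0]
      _ < (2 : ℝ) ^ (e + 1) := hv2
  have h6 := lt_of_mul_lt_mul_right h5 hu0.le
  rw [← Int.cast_abs] at h6
  exact_mod_cast h6

/-! ### "At least `m` identical bits after the round bit" and Lemma 2 -/

/-- **"`v` has at least `m` identical bits after the round bit"** (precision `p`, `v` in the binade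
`2^e ≤ |v| < 2^(e+1)`): the expansion of `|v|` is `b₁…b_{p+1} 0^m …` or `b₁…b_{p+1} 1^m …`, i.e. `v` is
within `2^(−m) ulp_{p+1} = 2^(e−p−m)` of a `(p+1)`-bit number ("`y` is representable on 54 bits").
Distance form; see the module doc for the (immaterial) boundary convention.
[cite: LefevreLyZimmermann2026, Appendix A] -/
def HasIdenticalBits (p m : ℕ) (e : ℤ) (v : ℝ) : Prop :=
  ∃ b : ℝ, IsFloat (p + 1) b ∧ |v - b| < (2 : ℝ) ^ (e - p - m)

/-- **Lemma 2** ("Algorithm Check is correct: if sin x has at least m identical bits after the round bit,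
then x is output"): for `m ≥ 1`, any nearest roundings `RN₁` to precision `p + m` and `RN₂` to precision
`p + 1`, and `|v| ≥ 2^e`: `HasIdenticalBits p m e v ⇒ RN₂ (RN₁ v) = RN₁ v` (lines 1–3 of Algorithm 4
with `y = RN₁ v`, `z = RN₂ y`). [cite: LefevreLyZimmermann2026, Appendix A, Lemma 2] -/
theorem check_outputs {p m : ℕ} {RN₁ RN₂ : ℝ → ℝ} (hp : 1 ≤ p) (hm : 1 ≤ m)
    (h₁ : IsRoundNearest (p + m) RN₁) (h₂ : IsRoundNearest (p + 1) RN₂) {v : ℝ} {e : ℤ}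
    (hv : (2 : ℝ) ^ e ≤ |v|) (hid : HasIdenticalBits p m e v) : RN₂ (RN₁ v) = RN₁ v := by
  obtain ⟨b, hb, hvb⟩ := hid
  have hexp : (e - (p : ℤ) - m) = e - ((p + m : ℕ) : ℤ) := by push_cast; ring
  rw [hexp] at hvb
  have hy : RN₁ v = b := rn_eq_of_near_float h₁ (by omega) (by omega) hv hb hvb
  rw [hy]
  exact h₂.rn_eq_self hb

/-- **Lemma 2, converse** ("when x is output by Check, sin x … has at least m identical bits after the
round bit … since sin x cannot be exact"): if `v` in the binade `2^e ≤ |v| < 2^(e+1)` is not a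
`(p+m+1)`-bit number and `RN₂ (RN₁ v) = RN₁ v`, then `HasIdenticalBits p m e v` — the witness is
`y = RN₁ v` itself. [cite: LefevreLyZimmermann2026, Appendix A, Lemma 2] -/
theorem hasIdenticalBits_of_check_outputs {p m : ℕ} {RN₁ RN₂ : ℝ → ℝ} (hp : 1 ≤ p)
    (h₁ : IsRoundNearest (p + m) RN₁) (h₂ : IsRoundNearest (p + 1) RN₂) {v : ℝ} {e : ℤ}
    (hv1 : (2 : ℝ) ^ e ≤ |v|) (hv2 : |v| < (2 : ℝ) ^ (e + 1)) (hnf : ¬ IsFloat (p + m + 1) v)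
    (hz : RN₂ (RN₁ v) = RN₁ v) : HasIdenticalBits p m e v := by
  refine ⟨RN₁ v, by rw [← hz]; exact h₂.isFloat _, ?_⟩
  have hle := abs_rn_sub_le_half_ulp h₁ (by omega) hv1 hv2
  have hexp : (e - (p : ℤ) - m) = e - ((p + m : ℕ) : ℤ) := by push_cast; ring
  rw [hexp, abs_sub_comm]
  rcases hle.lt_or_eq with hlt | heq
  · exact hlt
  · exact absurd (isFloat_succ_of_abs_sub_eq (by omega) (h₁.isFloat v) hv1 hv2 heq) hnf

/-- Lemma 2 with its converse: for `v` not a `(p+m+1)`-bit number (e.g. irrational) in the binade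
`2^e ≤ |v| < 2^(e+1)`, Check outputs iff `v` has at least `m` identical bits after the round bit.
[cite: LefevreLyZimmermann2026, Appendix A, Lemma 2] -/
theorem check_outputs_iff {p m : ℕ} {RN₁ RN₂ : ℝ → ℝ} (hp : 1 ≤ p) (hm : 1 ≤ m)
    (h₁ : IsRoundNearest (p + m) RN₁) (h₂ : IsRoundNearest (p + 1) RN₂) {v : ℝ} {e : ℤ}
    (hv1 : (2 : ℝ) ^ e ≤ |v|) (hv2 : |v| < (2 : ℝ) ^ (e + 1)) (hnf : ¬ IsFloat (p + m + 1) v) :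
    RN₂ (RN₁ v) = RN₁ v ↔ HasIdenticalBits p m e v :=
  ⟨hasIdenticalBits_of_check_outputs hp h₁ h₂ hv1 hv2 hnf, check_outputs hp hm h₁ h₂ hv1⟩

/-- Non-vacuity: in precision `p = 3`, `v = 141/125 = 1.128 = (1.001|000001…)₂` (round bit `b₄ = 1`,
then five `0`s) has at least `m = 2` identical bits after the round bit: it is within `2^(0−3−2) = 1/32`
of the 4-bit number `9/8 = 9·2^(−3)`. -/
example : HasIdenticalBits 3 2 0 ((141 : ℝ) / 125) :=
  ⟨9 / 8, ⟨9, -3, by norm_num, by norm_num⟩, by norm_num [abs_of_pos]⟩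

/-! ### Dictionary with the `m`-bad cases of [BrisebarreEtAl2025, §4.4] -/

/-- **"m identical bits after the round bit" = "(m+1)-bad, directed or to nearest".** With the scaled
value `y = 2^(p−1−e)·v` (ulp = 1; this is `scaled f p e₁ e X` when `v = f(X·2^(e₁−p+1))`), for `m ≥ 1` and
`2^e ≤ |v| < 2^(e+1)`: `HasIdenticalBits p m e v ↔ IsBadCaseDir (m+1) y ∨ IsBadCaseRN (m+1) y` — the
`(p+1)`-bit number `b` scales to a half-integer `K/2`; `K` even: `y` is within `2^(−(m+1))` of an integer
(run of bits EQUAL to the round bit: hard for the directed roundings), `K` odd: of a half-integer (run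
OPPOSITE to the round bit: hard for round-to-nearest).
[cite: LefevreLyZimmermann2026, Appendix A; BrisebarreEtAl2025, §4.4] -/
theorem hasIdenticalBits_iff_isBadCase {p m : ℕ} (hp : 1 ≤ p) (hm : 1 ≤ m) {v : ℝ} {e : ℤ}
    (hv1 : (2 : ℝ) ^ e ≤ |v|) (hv2 : |v| < (2 : ℝ) ^ (e + 1)) :
    HasIdenticalBits p m e v ↔
      IsBadCaseDir (m + 1) ((2 : ℝ) ^ ((p : ℤ) - 1 - e) * v) ∨
        IsBadCaseRN (m + 1) ((2 : ℝ) ^ ((p : ℤ) - 1 - e) * v) := by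
  have hc0 : (0 : ℝ) < (2 : ℝ) ^ ((p : ℤ) - 1 - e) := by positivity
  -- the scale factor against the three relevant powers of two
  have hc1 : (2 : ℝ) ^ ((p : ℤ) - 1 - e) * (2 : ℝ) ^ (e - p) = 1 / 2 := by
    rw [← zpow_add₀ two_ne_zero, show (p : ℤ) - 1 - e + (e - p) = -1 by ring]; norm_num
  have hc2 : (2 : ℝ) ^ ((p : ℤ) - 1 - e) * (2 : ℝ) ^ (e - p + 1) = 1 := by
    rw [← zpow_add₀ two_ne_zero, show (p : ℤ) - 1 - e + (e - p + 1) = 0 by ring, zpow_zero]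
  have hc3 : (2 : ℝ) ^ ((p : ℤ) - 1 - e) * (2 : ℝ) ^ (e - p - m) = (2 : ℝ) ^ (-((m + 1 : ℕ) : ℤ)) := by
    rw [← zpow_add₀ two_ne_zero]; congr 1; push_cast; ring
  have hquarter : (2 : ℝ) ^ (-((m + 1 : ℕ) : ℤ)) ≤ 1 / 4 := by
    calc (2 : ℝ) ^ (-((m + 1 : ℕ) : ℤ)) ≤ (2 : ℝ) ^ (-2 : ℤ) :=
          zpow_le_zpow_right₀ (by norm_num) (by push_cast; omega)
      _ = 1 / 4 := by norm_num
  have hyabs : |(2 : ℝ) ^ ((p : ℤ) - 1 - e) * v| < (2 : ℝ) ^ (p : ℤ) := by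
    rw [abs_mul, abs_of_pos hc0]
    calc (2 : ℝ) ^ ((p : ℤ) - 1 - e) * |v| < (2 : ℝ) ^ ((p : ℤ) - 1 - e) * (2 : ℝ) ^ (e + 1) :=
          mul_lt_mul_of_pos_left hv2 hc0
      _ = (2 : ℝ) ^ (p : ℤ) := by rw [← zpow_add₀ two_ne_zero]; congr 1; ring
  have h2p : (2 : ℝ) ^ (p : ℤ) = ((2 ^ p : ℤ) : ℝ) := by push_cast; rw [zpow_natCast]
  have h2p1 : (2 : ℝ) ^ ((p : ℤ) + 1) = ((2 ^ (p + 1) : ℤ) : ℝ) := by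
    push_cast; rw [← zpow_natCast]; push_cast; rfl
  constructor
  · rintro ⟨b, hb, hvb⟩
    -- |b| ≥ 2^e, else b ≤ 2^e − 2^(e−p−1) is too far from v
    have hbe : (2 : ℝ) ^ e ≤ |b| := by
      by_contra hlt
      push Not at hlt
      have hle := (isFloat_abs hb).le_sub_of_lt (by omega) hlt
      have hmono : (2 : ℝ) ^ (e - p - m) ≤ (2 : ℝ) ^ (e - ((p + 1 : ℕ) : ℤ)) :=
        zpow_le_zpow_right₀ (by norm_num) (by push_cast; omega)
      have h1 : |v| - |b| ≤ |v - b| := abs_sub_abs_le_abs_sub v b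
      linarith
    obtain ⟨K, hK⟩ := hb.exists_int_mul_of_le hbe
    have hexp : (e - ((p + 1 : ℕ) : ℤ) + 1) = e - p := by push_cast; ring
    rw [hexp] at hK
    have hKb : (2 : ℝ) ^ ((p : ℤ) - 1 - e) * b = (K : ℝ) / 2 := by
      rw [hK, mul_left_comm, hc1]; ring
    have hdist : |(2 : ℝ) ^ ((p : ℤ) - 1 - e) * v - (K : ℝ) / 2| < (2 : ℝ) ^ (-((m + 1 : ℕ) : ℤ)) := by
      rw [← hKb, ← mul_sub, abs_mul, abs_of_pos hc0, ← hc3]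
      exact mul_lt_mul_of_pos_left hvb hc0
    rcases Int.even_or_odd' K with ⟨k, rfl | rfl⟩
    · left
      refine ⟨k, ?_⟩
      have : (((2 * k : ℤ) : ℝ)) / 2 = (k : ℝ) := by push_cast; ring
      rwa [this] at hdist
    · right
      refine ⟨k, ?_⟩
      have : (((2 * k + 1 : ℤ) : ℝ)) / 2 = (k : ℝ) + 1 / 2 := by push_cast; ring
      rwa [this] at hdist
  · rintro (⟨k, hk⟩ | ⟨k, hk⟩)
    · -- b = k·2^(e−p+1) = (2k)·2^(e−p), |k| ≤ 2^p
      have hkabs : |k| ≤ 2 ^ (p + 1) := by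
        have h1 : |(k : ℝ)| < (2 : ℝ) ^ (p : ℤ) + 1 / 4 := by
          have := abs_sub_abs_le_abs_sub (k : ℝ) ((2 : ℝ) ^ ((p : ℤ) - 1 - e) * v)
          rw [abs_sub_comm] at hk
          linarith
        have h2 : |k| < 2 ^ p + 1 := by
          have h3 : |(k : ℝ)| < ((2 ^ p + 1 : ℤ) : ℝ) := by
            push_cast; rw [h2p] at h1; push_cast at h1; linarith
          rw [← Int.cast_abs] at h3
          exact_mod_cast h3
        calc |k| ≤ 2 ^ p := by omega
          _ ≤ 2 ^ (p + 1) := pow_le_pow_right₀ (by norm_num) (by omega)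
      refine ⟨(k : ℝ) * (2 : ℝ) ^ (e - p + 1), IsFloat.of_abs_le (by omega) hkabs, ?_⟩
      have hkb : (2 : ℝ) ^ ((p : ℤ) - 1 - e) * ((k : ℝ) * (2 : ℝ) ^ (e - p + 1)) = k := by
        rw [mul_left_comm, hc2, mul_one]
      have h5 : |(2 : ℝ) ^ ((p : ℤ) - 1 - e) * (v - (k : ℝ) * (2 : ℝ) ^ (e - p + 1))|
          = (2 : ℝ) ^ ((p : ℤ) - 1 - e) * |v - (k : ℝ) * (2 : ℝ) ^ (e - p + 1)| := by
        rw [abs_mul, abs_of_pos hc0]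
      have h6 : (2 : ℝ) ^ ((p : ℤ) - 1 - e) * (v - (k : ℝ) * (2 : ℝ) ^ (e - p + 1))
          = (2 : ℝ) ^ ((p : ℤ) - 1 - e) * v - k := by rw [mul_sub, hkb]
      have h7 : (2 : ℝ) ^ ((p : ℤ) - 1 - e) * |v - (k : ℝ) * (2 : ℝ) ^ (e - p + 1)|
          < (2 : ℝ) ^ ((p : ℤ) - 1 - e) * (2 : ℝ) ^ (e - p - m) := by
        rw [hc3, ← h5, h6]; exact hk
      exact lt_of_mul_lt_mul_left h7 hc0.le
    · -- b = (k + ½)·2^(e−p+1) = (2k+1)·2^(e−p), |2k+1| ≤ 2^(p+1)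
      have hkabs : |2 * k + 1| ≤ 2 ^ (p + 1) := by
        have h1 : |(k : ℝ) + 1 / 2| < (2 : ℝ) ^ (p : ℤ) + 1 / 4 := by
          have := abs_sub_abs_le_abs_sub ((k : ℝ) + 1 / 2) ((2 : ℝ) ^ ((p : ℤ) - 1 - e) * v)
          rw [abs_sub_comm] at hk
          linarith
        have h2 : |2 * k + 1| < 2 ^ (p + 1) + 1 := by
          have h3 : |((2 * k + 1 : ℤ) : ℝ)| < ((2 ^ (p + 1) + 1 : ℤ) : ℝ) := by
            have e2 : ((2 * k + 1 : ℤ) : ℝ) = 2 * ((k : ℝ) + 1 / 2) := by push_cast; ring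
            rw [e2, abs_mul, abs_of_pos (by norm_num : (0 : ℝ) < 2)]
            push_cast; rw [pow_succ]; rw [h2p] at h1; push_cast at h1; nlinarith
          rw [← Int.cast_abs] at h3
          exact_mod_cast h3
        omega
      refine ⟨((2 * k + 1 : ℤ) : ℝ) * (2 : ℝ) ^ (e - p), IsFloat.of_abs_le (by omega) hkabs, ?_⟩
      have hkb : (2 : ℝ) ^ ((p : ℤ) - 1 - e) * (((2 * k + 1 : ℤ) : ℝ) * (2 : ℝ) ^ (e - p))
          = (k : ℝ) + 1 / 2 := by
        rw [mul_left_comm, hc1]; push_cast; ring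
      have h5 : |(2 : ℝ) ^ ((p : ℤ) - 1 - e) * (v - ((2 * k + 1 : ℤ) : ℝ) * (2 : ℝ) ^ (e - p))|
          = (2 : ℝ) ^ ((p : ℤ) - 1 - e) * |v - ((2 * k + 1 : ℤ) : ℝ) * (2 : ℝ) ^ (e - p)| := by
        rw [abs_mul, abs_of_pos hc0]
      have h6 : (2 : ℝ) ^ ((p : ℤ) - 1 - e) * (v - ((2 * k + 1 : ℤ) : ℝ) * (2 : ℝ) ^ (e - p))
          = (2 : ℝ) ^ ((p : ℤ) - 1 - e) * v - ((k : ℝ) + 1 / 2) := by rw [mul_sub, hkb]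
      have h7 : (2 : ℝ) ^ ((p : ℤ) - 1 - e) * |v - ((2 * k + 1 : ℤ) : ℝ) * (2 : ℝ) ^ (e - p)|
          < (2 : ℝ) ^ ((p : ℤ) - 1 - e) * (2 : ℝ) ^ (e - p - m) := by
        rw [hc3, ← h5, h6]; exact hk
      exact lt_of_mul_lt_mul_left h7 hc0.le

/-- The dictionary on the grid of [BrisebarreEtAl2025, Problems 4.1/4.2]: for `x = X·2^(e₁−p+1)` with
`f x` in the binade `[2^e, 2^(e+1))` in absolute value,
`HasIdenticalBits p m e (f x) ↔ IsBadCaseDir (m+1) (scaled f p e₁ e X) ∨ IsBadCaseRN (m+1) (scaled f p e₁ e X)`.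
[cite: LefevreLyZimmermann2026, Appendix A; BrisebarreEtAl2025, §4.3–4.4] -/
theorem hasIdenticalBits_iff_isBadCase_scaled {p m : ℕ} (hp : 1 ≤ p) (hm : 1 ≤ m) (f : ℝ → ℝ)
    {e₁ e X : ℤ} (hv1 : (2 : ℝ) ^ e ≤ |f ((X : ℝ) * (2 : ℝ) ^ (e₁ - (p : ℤ) + 1))|)
    (hv2 : |f ((X : ℝ) * (2 : ℝ) ^ (e₁ - (p : ℤ) + 1))| < (2 : ℝ) ^ (e + 1)) :
    HasIdenticalBits p m e (f ((X : ℝ) * (2 : ℝ) ^ (e₁ - (p : ℤ) + 1))) ↔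
      IsBadCaseDir (m + 1) (scaled f p e₁ e X) ∨ IsBadCaseRN (m + 1) (scaled f p e₁ e X) :=
  hasIdenticalBits_iff_isBadCase hp hm hv1 hv2

/-! ### The instances of the paper: `sin`, `cos` (§IV), `tan` (§V) at floating-point arguments -/

/-- **Lemma 2 and its converse for `sin`**, any precision `p ≥ 1`, `m ≥ 1`: for a non-zero rational (in
particular binary64) `x` with `2^e ≤ |sin x| < 2^(e+1)`, Check outputs `x` iff `sin x` has at least `m`
identical bits after the round bit (`sin x` is transcendental, hence no float of any precision).
[cite: LefevreLyZimmermann2026, Appendix A, Lemma 2] -/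
theorem check_sin_iff {p m : ℕ} {RN₁ RN₂ : ℝ → ℝ} (hp : 1 ≤ p) (hm : 1 ≤ m)
    (h₁ : IsRoundNearest (p + m) RN₁) (h₂ : IsRoundNearest (p + 1) RN₂) {x : ℚ} (hx : x ≠ 0) {e : ℤ}
    (he1 : (2 : ℝ) ^ e ≤ |Real.sin x|) (he2 : |Real.sin x| < (2 : ℝ) ^ (e + 1)) :
    RN₂ (RN₁ (Real.sin x)) = RN₁ (Real.sin x) ↔ HasIdenticalBits p m e (Real.sin x) :=
  check_outputs_iff hp hm h₁ h₂ he1 he2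
    (not_isFloat_of_irrational (transcendental_sin_ratCast hx).irrational)

/-- The same for `cos` ("we ran our algorithms for all 1014 binades … [of] cos", §IV).
[cite: LefevreLyZimmermann2026, §IV and Appendix A] -/
theorem check_cos_iff {p m : ℕ} {RN₁ RN₂ : ℝ → ℝ} (hp : 1 ≤ p) (hm : 1 ≤ m)
    (h₁ : IsRoundNearest (p + m) RN₁) (h₂ : IsRoundNearest (p + 1) RN₂) {x : ℚ} (hx : x ≠ 0) {e : ℤ}
    (he1 : (2 : ℝ) ^ e ≤ |Real.cos x|) (he2 : |Real.cos x| < (2 : ℝ) ^ (e + 1)) :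
    RN₂ (RN₁ (Real.cos x)) = RN₁ (Real.cos x) ↔ HasIdenticalBits p m e (Real.cos x) :=
  check_outputs_iff hp hm h₁ h₂ he1 he2
    (not_isFloat_of_irrational (transcendental_cos_ratCast hx).irrational)

/-- The same for `tan` (§V). [cite: LefevreLyZimmermann2026, §V and Appendix A] -/
theorem check_tan_iff {p m : ℕ} {RN₁ RN₂ : ℝ → ℝ} (hp : 1 ≤ p) (hm : 1 ≤ m)
    (h₁ : IsRoundNearest (p + m) RN₁) (h₂ : IsRoundNearest (p + 1) RN₂) {x : ℚ} (hx : x ≠ 0) {e : ℤ}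
    (he1 : (2 : ℝ) ^ e ≤ |Real.tan x|) (he2 : |Real.tan x| < (2 : ℝ) ^ (e + 1)) :
    RN₂ (RN₁ (Real.tan x)) = RN₁ (Real.tan x) ↔ HasIdenticalBits p m e (Real.tan x) :=
  check_outputs_iff hp hm h₁ h₂ he1 he2 (not_isFloat_of_irrational (irrational_tan_ratCast hx))

/-- **Check ⟺ (m+1)-bad on the grid**, for `sin`: with `x = X·2^(e₁−p+1)` (`X ≠ 0`) and `sin x` in the
binade `[2^e, 2^(e+1))` in absolute value, Algorithm Check with parameter `m ≥ 1` outputs `x` iff `x` is an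
`(m+1)`-bad case of `sin` on the grid `(p, e₁, e)` for a directed rounding or for round-to-nearest — the
exact meaning of a line "`x` [with] at least `m` identical bits after the round bit" of the published
lists. [cite: LefevreLyZimmermann2026, §IV and Appendix A; BrisebarreEtAl2025, §4.4] -/
theorem check_sin_iff_isBadCase {p m : ℕ} {RN₁ RN₂ : ℝ → ℝ} (hp : 1 ≤ p) (hm : 1 ≤ m)
    (h₁ : IsRoundNearest (p + m) RN₁) (h₂ : IsRoundNearest (p + 1) RN₂) {X e₁ e : ℤ} (hX : X ≠ 0)
    (he1 : (2 : ℝ) ^ e ≤ |Real.sin ((X : ℝ) * (2 : ℝ) ^ (e₁ - (p : ℤ) + 1))|)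
    (he2 : |Real.sin ((X : ℝ) * (2 : ℝ) ^ (e₁ - (p : ℤ) + 1))| < (2 : ℝ) ^ (e + 1)) :
    RN₂ (RN₁ (Real.sin ((X : ℝ) * (2 : ℝ) ^ (e₁ - (p : ℤ) + 1))))
        = RN₁ (Real.sin ((X : ℝ) * (2 : ℝ) ^ (e₁ - (p : ℤ) + 1))) ↔
      IsBadCaseDir (m + 1) (scaled Real.sin p e₁ e X) ∨ IsBadCaseRN (m + 1) (scaled Real.sin p e₁ e X) := by
  have hx : ((X : ℚ) * (2 : ℚ) ^ (e₁ - (p : ℤ) + 1)) ≠ 0 :=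
    mul_ne_zero (Int.cast_ne_zero.2 hX) (zpow_ne_zero _ two_ne_zero)
  have hcast : (((X : ℚ) * (2 : ℚ) ^ (e₁ - (p : ℤ) + 1) : ℚ) : ℝ) = (X : ℝ) * (2 : ℝ) ^ (e₁ - (p : ℤ) + 1) := by
    push_cast; rfl
  have h := check_sin_iff hp hm h₁ h₂ hx (e := e) (by rw [hcast]; exact he1) (by rw [hcast]; exact he2)
  rw [hcast] at h
  rw [h]
  exact hasIdenticalBits_iff_isBadCase_scaled hp hm Real.sin he1 he2

end Literature.ComputerArithmetic.LefevreLyZimmermann2026
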